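import Summits.HodgeConjecture.HodgeConjecture.Theorems.F0P3FinPartConstituentTransfer   -- ★ p812428 (this seat): T♭-core `comap_smoothConstituents_transfer_cm`
import Literature.NumberTheory.Rogawski1990.GlobalAPacketMembership                        -- ★ D6 (typ3): `MemXiFamily`, `MemXiFamily.of_constituents`, frame lemmas
import Literature.NumberTheory.Automorphic.QuadraticHeckeCharacterCM                           -- ★ `quadraticHeckeCharCM` (ω_{L/L⁺})
import Literature.NumberTheory.Automorphic.QuadraticHeckeCharacterQuadExt                      -- ★ `quadraticHeckeCharCM_eq_quadraticHeckeCharExt`, `isUnitary_quadraticHeckeCharExt`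
import Literature.NumberTheory.Automorphic.AdeleBaseChange                                     -- ★ `AdeleRing.ideleBaseChange`
import Literature.NumberTheory.GaloisRepresentations.HeckeCharacterExtensionQuadraticGeneralProofs  -- ★ Hewitt–Ross `HewittRoss_heckeCharacter_extension_quadratic_holds`
import HarnessLib

/-!
# Crux `H413` — rung 3, T♭ PROPER: membership in a ξ-local family TRANSFERS across a common irreducible admissible finite component
# (the in-house replacement of the letter S3♭ [Rogawski1990, Thm. 13.3.5 / Thm. 14.6.4 proof l. 1] in the β_opp fold)

Floor-0 programme P3 «U3-mult», seat F0P3-p03 (g5); crux item stmt-HodgeConjecture-24833 (`HCCMUnconditional.H413`); F0P3-plan (g3)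
rulings (N6)/(R)/(T).  PROOF lane: no `def`, no `sorry`, no named fact; `--supports stmt-HodgeConjecture-24833`.
HONEST LABEL: HC_CM is proved only modulo the printed citations until rung 0 closes; this file discharges none of them — it REMOVES one
(S3♭ is not minted: the `_trans` fold ★ `F0P3SLayerFoldShapesAdm.betaOppAdm_pointwise_of_SLayer_trans` consumes `memXiFamily_transfer` below).

T♭ = D6's transfer plumbing ★ `MemXiFamily.of_constituents` (same ξ-local family `Pv`; only `LocalConstituentsIn` moves) fed with ★ T♭-core
`comap_smoothConstituents_transfer_cm` (I♭ finite-part isotypy ★ `F0P3FinPartIsotypic` + Σ♭ ★ `IrreducibleClassesConstituentsIsotypic` +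
inheritance ★ `F0P3FinRepConstituentsExist`): for `σ` irreducible ADMISSIBLE occurring in both `P` and `P′`, every (b2′)-constituent of `P′` at a
finite place is one of `P`, so a family containing the constituents of `P` contains those of `P′`.

* `memXiFamily_of_common_finComponent` — pointwise: `MemXiFamily P … ξ → MemXiFamily P′ … ξ`.
* **`memXiFamily_transfer`** — the `hTransAdm` hypothesis of ★ `betaOppAdm_pointwise_of_SLayer_trans` at `Mem := fun P ξ => MemXiFamily P hH hHd μω hμu ξ`,
  binder for binder: `∀ W σ, σ.IsIrreducible → σ.IsSmooth → σ.IsAdmissible → ∀ P P′ ξ, P.HasFinComponent σ → P′.HasFinComponent σ → Mem P ξ → Mem P′ ξ`.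
* **`memXiFamily_transfer_cm`** — CONTRACT T♭-v1 (F0P3-plan (g3) 06:00Z, BY NAME for ED. 3): the same at the FRAME `(L ι H T hT μ μω hμu)` with
  `hH := transpose_map_cmConjRingHom_eq_of_frame L ι H T hT`, `hHd := isUnit_det_of_frame L ι H T hT` (= the planner's `def TFlatShape` body).
* `exists_muOmega` — ED. 3's auxiliary `μω`: a UNITARY Hecke character of `L` extending `ω_{L/L⁺}` exists (★ Hewitt–Ross extension + ★ unitarity of
  `ω_{L/L⁺}`), banked here so that the letters file (B) stays frozen.

References: D. Flath, PSPM 33.1 (1979) Thm. 3–4 [FlathCorvallis1979]; J. Rogawski, Ann. of Math. Stud. 123 (1990) Thm. 13.3.5, §14.6 p. 244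
(the printed step this replaces) [Rogawski1990]; N. Bourbaki, *Algèbre* VIII (2012) §4 [BourbakiAlgebreVIII2012].
-/

set_option autoImplicit false
-- the mandated namespace repeats `HodgeConjecture.HodgeConjecture`, as in every `Theorems/*.lean` of this sub-problem
set_option linter.dupNamespace false

noncomputable section

open scoped Matrix
open MeasureTheory NumberField IsDedekindDomain

namespace Summit.HodgeConjecture.HodgeConjecture.Cruxes.H413.F0P3MemXiFamilyTransfer

open Literature.NumberTheory.Automorphic Literature.NumberTheory.Automorphic.UnitaryGroup
open Literature.NumberTheory.Rogawski1990
open Summit.HodgeConjecture.HodgeConjecture.Cruxes.H413.F0P3FinPartConstituentTransfer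

variable {L : Type} [Field L] [NumberField L] [IsCMField L] {H : Matrix (Fin 3) (Fin 3) L}
  {μ : Measure (adelicGroupData (↥(maximalRealSubfield L)) L (IsCMField.complexConj L) 3 H).automorphicQuotient}
  [(adelicGroupData (↥(maximalRealSubfield L)) L (IsCMField.complexConj L) 3 H).IsAutomorphicMeasure μ]

/-- **T♭ — TRANSFER OF ξ-FAMILY MEMBERSHIP ACROSS A COMMON ADMISSIBLE FINITE COMPONENT** (pointwise): if the irreducible admissible `σ`
occurs in both `P` and `P′`, then `MemXiFamily P … ξ → MemXiFamily P′ … ξ` — the same ξ-local family serves `P′`, its local constituents being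
those of `P` (★ T♭-core). [cite: FlathCorvallis1979, Thm. 3] [cite: Rogawski1990, §14.6 p. 244] -/
theorem memXiFamily_of_common_finComponent
    {hH : (H.map (cmConjRingHom L))ᵀ = H} {hHd : IsUnit H.det} {μω : Literature.NumberTheory.GaloisRepresentations.HeckeCharacter L}
    {hμu : μω.IsUnitary} {ξ : OneDimAutRepH L}
    (P P' : DiscreteAutomorphicRep (adelicGroupData (↥(maximalRealSubfield L)) L (IsCMField.complexConj L) 3 H) μ)
    {W : Type} [AddCommGroup W] [Module ℂ W]
    {σ : Representation ℂ (finAdelic (↥(maximalRealSubfield L)) L (IsCMField.complexConj L) 3 H) W}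
    (hirr : σ.IsIrreducible) (hadm : σ.IsAdmissible) (hP : P.HasFinComponent σ) (hP' : P'.HasFinComponent σ)
    (h : MemXiFamily P hH hHd μω hμu ξ) : MemXiFamily P' hH hHd μω hμu ξ :=
  h.of_constituents fun v c hc => comap_smoothConstituents_transfer_cm P P' hirr hadm hP hP' v c hc

/-- **T♭ in the `hTransAdm` shape of ★ `F0P3SLayerFoldShapesAdm.betaOppAdm_pointwise_of_SLayer_trans`** at
`Mem := fun P ξ => MemXiFamily P hH hHd μω hμu ξ` (datum fixed): `∀ W σ, irreducible → smooth → admissible → ∀ P P′ ξ,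
P.HasFinComponent σ → P′.HasFinComponent σ → Mem P ξ → Mem P′ ξ`. [cite: FlathCorvallis1979, Thm. 3] [cite: Rogawski1990, §14.6 p. 244] -/
theorem memXiFamily_transfer (hH : (H.map (cmConjRingHom L))ᵀ = H) (hHd : IsUnit H.det)
    (μω : Literature.NumberTheory.GaloisRepresentations.HeckeCharacter L) (hμu : μω.IsUnitary) :
    ∀ (W : Type) [AddCommGroup W] [Module ℂ W]
      (σ : Representation ℂ (finAdelic (↥(maximalRealSubfield L)) L (IsCMField.complexConj L) 3 H) W),
      σ.IsIrreducible → σ.IsSmooth → σ.IsAdmissible →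
      ∀ (P P' : DiscreteAutomorphicRep (adelicGroupData (↥(maximalRealSubfield L)) L (IsCMField.complexConj L) 3 H) μ)
        (ξ : OneDimAutRepH L), P.HasFinComponent σ → P'.HasFinComponent σ →
        MemXiFamily P hH hHd μω hμu ξ → MemXiFamily P' hH hHd μω hμu ξ :=
  fun _W _ _ _σ hirr _hsm hadm P P' _ξ hP hP' h => memXiFamily_of_common_finComponent P P' hirr hadm hP hP' h

/-- **CONTRACT T♭-v1 (BY NAME for ED. 3)**: T♭ at the frame `(L, ι, H, T, hT, μ)` and auxiliary `μω`, with D6's hermitian∕unit-determinant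
inputs derived from the frame (★ `transpose_map_cmConjRingHom_eq_of_frame`, ★ `isUnit_det_of_frame`) — token for token the planner's `TFlatShape`
body, i.e. the `hTransAdm` hypothesis of ★ `betaOppAdm_pointwise_of_SLayer_trans` at
`Mem := fun P ξ => MemXiFamily P (transpose_map_cmConjRingHom_eq_of_frame L ι H T hT) (isUnit_det_of_frame L ι H T hT) μω hμu ξ`.
[cite: FlathCorvallis1979, Thm. 3] [cite: Rogawski1990, §14.6 p. 244] -/
theorem memXiFamily_transfer_cm (L : Type) [Field L] [NumberField L] [IsCMField L] (ι : L →+* ℂ) (H : Matrix (Fin 3) (Fin 3) L)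
    (T : GL (Fin 3) ℂ)
    (hT : (T : Matrix (Fin 3) (Fin 3) ℂ)ᴴ * H.map ι * (T : Matrix (Fin 3) (Fin 3) ℂ) = Literature.Geometry.ComplexHyperbolic.BallModel.J)
    (μ : Measure (adelicGroupData (↥(maximalRealSubfield L)) L (IsCMField.complexConj L) 3 H).automorphicQuotient)
    [(adelicGroupData (↥(maximalRealSubfield L)) L (IsCMField.complexConj L) 3 H).IsAutomorphicMeasure μ]
    (μω : Literature.NumberTheory.GaloisRepresentations.HeckeCharacter L) (hμu : μω.IsUnitary) :
    ∀ (W : Type) [AddCommGroup W] [Module ℂ W]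
      (σ : Representation ℂ (finAdelic (↥(maximalRealSubfield L)) L (IsCMField.complexConj L) 3 H) W),
      σ.IsIrreducible → σ.IsSmooth → σ.IsAdmissible →
      ∀ (P P' : DiscreteAutomorphicRep (adelicGroupData (↥(maximalRealSubfield L)) L (IsCMField.complexConj L) 3 H) μ) (ξ : OneDimAutRepH L),
        P.HasFinComponent σ → P'.HasFinComponent σ →
        MemXiFamily P (transpose_map_cmConjRingHom_eq_of_frame L ι H T hT) (isUnit_det_of_frame L ι H T hT) μω hμu ξ →
        MemXiFamily P' (transpose_map_cmConjRingHom_eq_of_frame L ι H T hT) (isUnit_det_of_frame L ι H T hT) μω hμu ξ :=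
  memXiFamily_transfer (transpose_map_cmConjRingHom_eq_of_frame L ι H T hT) (isUnit_det_of_frame L ι H T hT) μω hμu

/-- **ED. 3's auxiliary `μω` EXISTS**: a UNITARY Hecke character of the CM field `L` whose restriction to the idèles of `L⁺` is the quadratic
character `ω_{L/L⁺}` (★ `quadraticHeckeCharCM`) — ★ Hewitt–Ross extension of the unitary character `ω_{L/L⁺}` (★ `isUnitary_quadraticHeckeCharExt`
via ★ `quadraticHeckeCharCM_eq_quadraticHeckeCharExt`) through the closed embedding `𝕀_{L⁺} ↪ 𝕀_L`. [cite: Rogawski1990, §12.2 p. 174]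
[cite: HewittRoss1979, Thm. (24.12)] [cite: Weil1956, §1] -/
theorem exists_muOmega (L : Type) [Field L] [NumberField L] [IsCMField L] :
    ∃ μω : Literature.NumberTheory.GaloisRepresentations.HeckeCharacter L, μω.IsUnitary ∧
      ∀ x : Literature.NumberTheory.GaloisRepresentations.ideleGroup ↥(maximalRealSubfield L),
        μω (AdeleRing.ideleBaseChange (↥(maximalRealSubfield L)) L x) = quadraticHeckeCharCM L x := by
  have hω : (quadraticHeckeCharCM L).IsUnitary := by
    rw [quadraticHeckeCharCM_eq_quadraticHeckeCharExt]; exact isUnitary_quadraticHeckeCharExt _ _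
  obtain ⟨χ, hχu, hχ, -⟩ := Literature.NumberTheory.GaloisRepresentations.HewittRoss_heckeCharacter_extension_quadratic_holds
    (↥(maximalRealSubfield L)) L (IsCMField.complexConj L) (Algebra.IsQuadraticExtension.finrank_eq_two _ L)
    (IsCMField.complexConj_ne_one (K := L)) (quadraticHeckeCharCM L) hω ∅ (fun u hu => absurd hu (Set.notMem_empty u))
  exact ⟨χ, hχu, hχ⟩

end Summit.HodgeConjecture.HodgeConjecture.Cruxes.H413.F0P3MemXiFamilyTransfer

end
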